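import Mathlib

/-!
# SpanThreshold — the kernel step of T-M1D.24 (span-threshold theorem), m1-4 g10

HONEST FRAMING: first certified bounds; not a superconductivity verdict; every number certified
or labelled float.  This file is pure finite-dimensional linear algebra.

Context (STRUCTURE-TM1-doped.md, T-M1D.24 (b)): on an `S`-site window the one-body matrix `Γ` of
one spin species is real positive semidefinite with constant diagonal `γ₀` (the density) and,
at the kinetic floor, first off-diagonal `γ₁ = γ₀`.  Then consecutive columns of `Γ` coincide
(`xᵀ Γ x = 0 ⇒ Γ x = 0` with `x = e_i - e_{i+1}`), so `Γ` is the constant matrix, and the Pauli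
constraint `Γ ≤ 1` tested on the all-ones vector gives `S • γ₀ ≤ 1` — the threshold `n • S ≤ 2`
of C-M1D-7′ (with `γ₀ = n / 2`).
-/

namespace Summit.Ventures.CertifiedManyBodySolver.Conjectures.SpanThreshold

open Matrix

variable {n : Type*} [Fintype n] [DecidableEq n]

/-- Kernel step: for a real positive semidefinite matrix, `A i i = A j j = A i j` forces the
columns `i` and `j` to agree (the vector `e_i - e_j` has zero quadratic form, hence lies in the
kernel). -/
theorem col_eq_of_posSemidef {A : Matrix n n ℝ} (hA : A.PosSemidef) {i j : n}
    (hii : A i i = A i j) (hjj : A j j = A i j) (k : n) : A k i = A k j := by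
  have hsymm : A j i = A i j := by
    have h := hA.1.apply i j
    rwa [star_trivial] at h
  set x : n → ℝ := Pi.single i 1 - Pi.single j 1 with hx
  have hAx : A *ᵥ x = fun k => A k i - A k j := by
    funext k
    rw [hx, Matrix.mulVec_sub, Pi.sub_apply, Matrix.mulVec_single_one, Matrix.mulVec_single_one]
    rfl
  have hq : star x ⬝ᵥ A *ᵥ x = 0 := by
    rw [star_trivial, hAx, hx, sub_dotProduct, single_one_dotProduct, single_one_dotProduct]
    linarith
  have hker : A *ᵥ x = 0 := (hA.dotProduct_mulVec_zero_iff x).1 hq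
  have hk := congr_fun hker k
  rw [hAx] at hk
  simpa [sub_eq_zero] using hk

/-- Constancy: a real PSD matrix on `Fin (S+1)` with constant diagonal `a` and first
off-diagonal `a` (the translation-invariant kinetic floor `γ₁ = γ₀`) is the constant matrix. -/
theorem const_of_posSemidef_floor {S : ℕ} {A : Matrix (Fin (S + 1)) (Fin (S + 1)) ℝ}
    (hA : A.PosSemidef) (a : ℝ) (hdiag : ∀ i, A i i = a)
    (hoff : ∀ i : Fin S, A i.castSucc i.succ = a) (i j : Fin (S + 1)) : A i j = a := by
  -- every column equals column 0
  have hcol : ∀ j : Fin (S + 1), ∀ k, A k j = A k 0 := by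
    intro j
    induction j using Fin.induction with
    | zero => intro k; rfl
    | succ j ih =>
      intro k
      have h1 : A k j.castSucc = A k j.succ :=
        col_eq_of_posSemidef hA (by rw [hdiag, hoff]) (by rw [hdiag, hoff]) k
      rw [← h1, ih]
  have hsymm : ∀ p q, A p q = A q p := by
    intro p q
    have h := hA.1.apply q p
    rwa [star_trivial] at h
  rw [hcol j i, hsymm i 0, hcol i 0, hdiag]

/-- Pauli threshold: if moreover `1 - A` is positive semidefinite (occupation numbers `≤ 1`),
then `(S+1) • a ≤ 1` — tested on the all-ones vector.  With `a = n/2` (density per species) and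
window size `S+1` this is the `U = 0` span threshold `n • (S+1) ≤ 2` of C-M1D-7′ / T-M1D.24 (b). -/
theorem pauli_threshold {S : ℕ} {A : Matrix (Fin (S + 1)) (Fin (S + 1)) ℝ}
    (hA : A.PosSemidef) (h1 : (1 - A).PosSemidef) (a : ℝ) (hdiag : ∀ i, A i i = a)
    (hoff : ∀ i : Fin S, A i.castSucc i.succ = a) : ((S : ℝ) + 1) * a ≤ 1 := by
  have hconst : ∀ i j, A i j = a := const_of_posSemidef_floor hA a hdiag hoff
  have hmv : (1 - A) *ᵥ (fun _ => (1 : ℝ)) = fun _ => 1 - ((S : ℝ) + 1) * a := by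
    funext k
    simp only [Matrix.mulVec, dotProduct, mul_one, Matrix.sub_apply, Matrix.one_apply, hconst,
      Finset.sum_sub_distrib, Finset.sum_ite_eq, Finset.mem_univ, if_true, Finset.sum_const,
      Finset.card_univ, Fintype.card_fin, nsmul_eq_mul, Nat.cast_add, Nat.cast_one]
  have hnn : 0 ≤ star (fun _ : Fin (S + 1) => (1 : ℝ)) ⬝ᵥ (1 - A) *ᵥ (fun _ => (1 : ℝ)) :=
    h1.dotProduct_mulVec_nonneg _
  rw [star_trivial, hmv] at hnn
  simp only [dotProduct, one_mul, Finset.sum_const, Finset.card_univ, Fintype.card_fin,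
    nsmul_eq_mul, Nat.cast_add, Nat.cast_one] at hnn
  have hS : (0 : ℝ) < (S : ℝ) + 1 := by positivity
  nlinarith

end Summit.Ventures.CertifiedManyBodySolver.Conjectures.SpanThreshold
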